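import Literature.NumberTheory.Automorphic.Liu2021.LemD1AsPrintedIndexed
import Literature.NumberTheory.Automorphic.Liu2021.LemD1LocalInjectivity
import Literature.NumberTheory.Automorphic.AdicCompletionLocalField
import Mathlib.RingTheory.SimpleModule.Rank
import Mathlib.RingTheory.RootsOfUnity.Complex
import HarnessLib

/-!
# [Liu2021, App. D Lemma D.1 (1) ∧ (3)] as printed on an INDEXED collection — NON-VACUITY of the hypothesis pair
# (kernel certificate, with two DISTINCT Step-2 characters `μ₀ ≠ μ₁`)

Reproduction ∕ bookkeeping (Literature, theorems only, no record, no definition, nothing asserted about Liu's objects).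
The statement-exact records `LemD1IndexedFamily.Item1AsPrinted` (Lemma D.1, first sentence + (1), member by member)
and `LemD1_3AsPrintedI` (Lemma D.1 (3): «If `n ≥ 3`, then `ω(μ', ε', χ')` is isomorphic to `ω(μ, ε, χ)` if and only if
`(μ', ε', χ') = (μ, ε, χ)`», read on an indexed collection, `LemD1AsPrintedIndexed.lean`) are PREDICATES on a consumer's
datum `Lf : LemD1IndexedFamily F E n ι` with many REAL constraints (a non-archimedean local field, the tree's hardened
standing data, Step-2 characters `μ_i ∈ MuSet S` with the norm-one ∕ continuity ∕ kernel clauses, …).  The sibling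
`LemD1AsPrintedNonVacuity.lean` certifies that item (1) alone is satisfiable at ONE datum.  This file certifies IN THE
KERNEL that the PAIR «(1) for every member ∧ (3)» is JOINTLY SATISFIABLE at the Hodge/CM cells' rank `n = 3` on a
collection with TWO members carrying DIFFERENT Step-2 characters `μ₀ ≠ μ₁` (same `ε`, same `χ`) and NON-ISOMORPHIC
`ω(μ₀, ε, χ) ≇ ω(μ₁, ε, χ)` — so item (3) is witnessed non-trivially in both directions of its «if and only if» (equal
parameters ↦ isomorphic, on the diagonal; different `μ` ↦ non-isomorphic, off the diagonal), and the pair of records does not,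
by its shape alone, force either `False` or the collapse «all `μ_i` are equal» of the index set.

THE WITNESS (split case of Liu's proof, l. 5241: «We identify `U(V)` with `GL_n(F)` … through the first factor»): `F = K_v`
the completion of a number field at a finite place, `E = F × F` with the swap (the tree's `SplitPlace.splitData`, Gram matrix
`(1, 1)`), `ε = (1, −1)`, `χ = 1` for both members; `μ₀ = 1` and `μ₁(x, y) = ν(x) ν(y)²` where `ν(x) = ζ₃^{ord_v x}` is the
unramified cubic character of `F^×` (`ζ₃ = e^{2πi/3}`; `μ₁|_{F^×} = ν³ = 1`, as Step 2 demands at a split place); the carriers are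
the characters `1` and `g ↦ ν(det g¹)` of `U(V)(F) ≅ GL₃(F)` on `ℂ` (trivial on the centre `E¹`, since `ν³ = 1`, so the maximal
`χ`-quotients are the lines themselves: irreducible, admissible — the stabilisers contain the open set `{ord_v det g¹ = 0}` —
and non-zero; `E` is not a field, so both sides of (1) are false); `g₀ = diag(ϖ, 1, 1)` acts by `ζ₃⁻¹ ≠ 1` on the second
line and trivially on the first, so the two quotients are not isomorphic.

Consequence (T5-style consistency, our bookkeeping): no contradiction is derivable from
`(Lf : LemD1IndexedFamily …) (h₁ : Lf.Item1AsPrinted) (h₃ : LemD1_3AsPrintedI Lf)` together with `∃ i j, Lf.mu i ≠ Lf.mu j`;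
it says nothing about the truth of Lemma D.1 for Liu's `ω(μ, ε)` or for the tree's constructed local data.

Cell pub-hodgecm2 (COR-CM), Δ2 BRIDGE cite leg `hμsep` ∕ END rows `hD1″`, `hD3` (which display exactly these two records at the
tree's local data); seat prover-pub-hodgecm2-b10 (the lineage that filed `LemD1AsPrintedIndexed.lean`).  HC_CM is NOT proved.

Reference: Y. Liu, *Fourier–Jacobi cycles and arithmetic relative trace formula*, Camb. J. Math. 9 (2021) = arXiv:2102.11518,
App. D §D.1 Steps 1–3 (`FJcycle.tex` l. 5213–5224), Lemma D.1 (1) (l. 5229), (3) (l. 5233); split case of the proof, l. 5241.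
-/

noncomputable section

open Literature.RepresentationTheory.Liu2021 (OscillatorStandingData)
open Literature.RepresentationTheory.CentralCharacterQuotient (augmentation quotRep quotRep_mk)

namespace Literature.NumberTheory.Automorphic.Liu2021

namespace LemD1IndexedNonVacuity

/-! ## §1 One-dimensional carriers: a character of `U(V)(F)` trivial on the centre -/

section Character

variable {F E : Type} [Field F] [ValuativeRel F] [TopologicalSpace F] [CommRing E] [Algebra F E]
  [TopologicalSpace E] [IsTopologicalRing E] {n : ℕ}

omit [IsTopologicalRing E] in
/-- For a datum whose carrier `ω(μ, ε)` is the line `ℂ` with `U(V)(F)` acting through a character `λ` that agrees with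
`χ` on the centre `E¹`, the `χ`-augmentation submodule vanishes: the maximal `χ`-quotient `ω(μ, ε, χ)` is the line itself.
[folklore] -/
private theorem augmentation_eq_bot_of_character (L : LemD1Data F E n ℂ) (lam : L.S.U →* ℂˣ)
    (hω : ∀ (g : L.S.U) (x : ℂ), L.omega g x = (lam g : ℂ) * x)
    (hcen : ∀ z : L.S.normOne, lam (L.S.scalar z) = L.chi z) :
    augmentation L.omega L.S.scalar L.chi = ⊥ := by
  unfold augmentation
  refine iSup_eq_bot.2 fun z => ?_
  rw [LinearMap.range_eq_bot]
  ext
  simp [hω, hcen]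

omit [IsTopologicalRing E] in
/-- On such a datum `U(V)(F)` acts on `ω(μ, ε, χ)` through `λ`. [folklore] -/
private theorem datum_quot_apply_of_character (L : LemD1Data F E n ℂ) (lam : L.S.U →* ℂˣ)
    (hω : ∀ (g : L.S.U) (x : ℂ), L.omega g x = (lam g : ℂ) * x) (g : L.S.U)
    (w : ℂ ⧸ augmentation L.omega L.S.scalar L.chi) : L.datum.quot g w = (lam g : ℂ) • w := by
  obtain ⟨y, rfl⟩ := Submodule.Quotient.mk_surjective _ w
  rw [LemD1Data.datum_quot, quotRep_mk, hω, ← smul_eq_mul, Submodule.Quotient.mk_smul]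

/-- **Item (1) as printed HOLDS at a character datum**: if `ω(μ, ε)` is the line `ℂ` with `U(V)(F)` acting through a
character `λ` which agrees with `χ` on the centre and is trivial on an open neighbourhood of `1`, and `E` is not a field,
then `LemD1_1AsPrinted L` — the maximal `χ`-quotient is a line (irreducible, admissible, non-zero) and both sides of the
printed equivalence (1) are false. [cite: Liu2021, App. D Lemma D.1 (1)] -/
theorem lemD1_1AsPrinted_of_character (L : LemD1Data F E n ℂ) (lam : L.S.U →* ℂˣ)
    (hω : ∀ (g : L.S.U) (x : ℂ), L.omega g x = (lam g : ℂ) * x)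
    (hcen : ∀ z : L.S.normOne, lam (L.S.scalar z) = L.chi z)
    (hopen : ∃ O : Set L.S.U, IsOpen O ∧ (1 : L.S.U) ∈ O ∧ ∀ g ∈ O, lam g = 1)
    (hE : ¬ IsField E) : LemD1_1AsPrinted L := by
  have hN := augmentation_eq_bot_of_character L lam hω hcen
  have hfin : Module.finrank ℂ (ℂ ⧸ augmentation L.omega L.S.scalar L.chi) = 1 := by
    rw [(Submodule.quotEquivOfEqBot _ hN).finrank_eq, Module.finrank_self]
  haveI hsimple : IsSimpleModule ℂ (ℂ ⧸ augmentation L.omega L.S.scalar L.chi) :=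
    isSimpleModule_iff_finrank_eq_one.2 hfin
  have hact := datum_quot_apply_of_character L lam hω
  refine ⟨⟨?_, ?_, ?_⟩, ?_⟩
  · -- irreducible-or-zero: submodules of a one-dimensional space
    intro W
    rcases eq_bot_or_eq_top W.toSubmodule with h | h
    · exact Or.inl (Subrepresentation.toSubmodule_injective h)
    · exact Or.inr (Subrepresentation.toSubmodule_injective h)
  · -- smooth: every stabiliser contains the open neighbourhood `O` of `1`, hence is an open subgroup
    intro x
    obtain ⟨O, hO, h1O, hlam⟩ := hopen
    change IsOpen (L.datum.quot.stabilizerSubgroup x : Set L.S.U)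
    refine Subgroup.isOpen_of_mem_nhds _ (g := 1) (Filter.mem_of_superset (hO.mem_nhds h1O) fun g hg => ?_)
    change L.datum.quot g x = x
    rw [hact, hlam g hg, Units.val_one, one_smul]
  · -- finitely generated fixed vectors
    intro K _
    infer_instance
  · -- item (1): both sides are false
    refine iff_of_false ?_ ?_
    · rw [not_subsingleton_iff_nontrivial]
      exact Module.nontrivial_of_finrank_pos (R := ℂ) (by rw [hfin]; exact one_pos)
    · exact fun h => hE h.1

end Character

/-! ## §2 Two character lines with different characters are not isomorphic -/

/-- Two lines `ℂ` on which a group acts through characters `λ₁` and `1`, with `λ₁ g₀ ≠ 1` for some `g₀`, have NON-isomorphic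
maximal `χ`-quotients (the first quotient being the line itself): an intertwining equivalence would carry the non-zero vector
`1` to a vector fixed by `g₀` and multiplied by `λ₁ g₀` at once. [folklore] -/
private theorem not_areIsomorphicRep_quotRep_of_character {G Z : Type*} [Group G] [Group Z]
    (ρ₁ ρ₀ : Representation ℂ G ℂ) {ζ : Z →* G} (hζ : ∀ z, ζ z ∈ Subgroup.center G) (χ₁ χ₀ : Z →* ℂˣ)
    (lam : G →* ℂˣ) (h₁ : ∀ (g : G) (x : ℂ), ρ₁ g x = (lam g : ℂ) * x) (h₀ : ∀ (g : G) (x : ℂ), ρ₀ g x = x)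
    (hN₁ : augmentation ρ₁ ζ χ₁ = ⊥) {g₀ : G} (hg₀ : lam g₀ ≠ 1) :
    ¬ AreIsomorphicRep (quotRep ρ₁ hζ χ₁) (quotRep ρ₀ hζ χ₀) := by
  rintro ⟨f, hf⟩
  have hw0 : (Submodule.Quotient.mk 1 : ℂ ⧸ augmentation ρ₁ ζ χ₁) ≠ 0 := by
    rw [Ne, Submodule.Quotient.mk_eq_zero, hN₁, Submodule.mem_bot]
    exact one_ne_zero
  have h1 : quotRep ρ₁ hζ χ₁ g₀ (Submodule.Quotient.mk 1) =
      (lam g₀ : ℂ) • (Submodule.Quotient.mk 1 : ℂ ⧸ augmentation ρ₁ ζ χ₁) := by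
    rw [quotRep_mk, h₁, ← smul_eq_mul, Submodule.Quotient.mk_smul]
  have h2 : ∀ y : ℂ ⧸ augmentation ρ₀ ζ χ₀, quotRep ρ₀ hζ χ₀ g₀ y = y := by
    intro y
    obtain ⟨u, rfl⟩ := Submodule.Quotient.mk_surjective _ y
    rw [quotRep_mk, h₀]
  have key := hf g₀ (Submodule.Quotient.mk 1)
  rw [h1, h2, map_smul] at key
  have hsub : ((lam g₀ : ℂ) - 1) • f (Submodule.Quotient.mk 1) = 0 := by
    rw [sub_smul, one_smul, key, sub_self]
  rcases smul_eq_zero.1 hsub with h | h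
  · exact hg₀ (Units.ext (sub_eq_zero.1 h))
  · exact hw0 (f.injective (by rw [h, map_zero]))

/-! ## §3 The unramified cubic character `x ↦ ζ₃^{ord x}` of a completed number field -/

section Cubic

open _root_.IsDedekindDomain _root_.NumberField
open scoped _root_.NumberField

/-- **An unramified cubic character of `K_v^×`**: for `ζ₃ = e^{2πi/3}` the map `x ↦ ζ₃^{ord_v x}` is a unitary character of
`K_v^×`, continuous (indeed locally constant: `ord_v` is locally constant off `0`), trivial on the units `ord_v x = 0`, of
order dividing `3`, and non-trivial (value `ζ₃⁻¹ ≠ 1` at a uniformiser `ϖ`, `ord_v ϖ = … = v(ϖ) = exp(−1)` in Mathlib's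
multiplicative notation).  Stated as an existence so that no definition is introduced. [folklore] -/
private theorem exists_cubic_unramified_character (K : Type) [Field K] [NumberField K] (v : HeightOneSpectrum (𝓞 K)) :
    ∃ ν : (v.adicCompletion K)ˣ →* ℂˣ,
      (∀ x, ‖((ν x : ℂˣ) : ℂ)‖ = 1) ∧
      (Continuous fun x : (v.adicCompletion K)ˣ => ((ν x : ℂˣ) : ℂ)) ∧
      (∀ x : (v.adicCompletion K)ˣ, Valued.v (x : v.adicCompletion K) = 1 → ν x = 1) ∧
      (∀ x, ν x ^ 3 = 1) ∧
      ∃ ϖ : (v.adicCompletion K)ˣ, ν ϖ ≠ 1 := by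
  -- the primitive cube root of unity `ζ₃ = e^{2πi/3}` as a unit of `ℂ`
  have hprim : IsPrimitiveRoot (Complex.exp (2 * Real.pi * Complex.I / (3 : ℕ))) 3 := Complex.isPrimitiveRoot_exp 3 (by norm_num)
  set ζ : ℂˣ := (hprim.isUnit (by norm_num)).unit with hζdef
  have hζval : (ζ : ℂ) = Complex.exp (2 * Real.pi * Complex.I / (3 : ℕ)) := (hprim.isUnit (by norm_num)).unit_spec
  have hζ : IsPrimitiveRoot ζ 3 := IsPrimitiveRoot.coe_units_iff.1 (by rw [hζval]; exact hprim)
  have hζ3 : ζ ^ 3 = 1 := hζ.pow_eq_one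
  have hζne : ζ ≠ 1 := hζ.ne_one (by norm_num)
  have hζnorm : ‖(ζ : ℂ)‖ = 1 := by rw [hζval]; exact hprim.norm'_eq_one (by norm_num)
  -- `x ↦ ζ^{ord x}` as a monoid-with-zero hom `K_v → ℂ`, then on units
  set f : Multiplicative ℤ →* ℂ := (Units.coeHom ℂ).comp (zpowersHom ℂˣ ζ) with hfdef
  set ν₀ : v.adicCompletion K →*₀ ℂ :=
    (WithZero.lift' f).comp (Valued.v : Valuation (v.adicCompletion K) (WithZero (Multiplicative ℤ))).toMonoidWithZeroHom
    with hν₀def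
  have hν₀ : ∀ x : v.adicCompletion K, x ≠ 0 →
      ν₀ x = ((ζ ^ WithZero.log (Valued.v x) : ℂˣ) : ℂ) := by
    intro x hx
    have hvx : Valued.v x ≠ 0 := (Valuation.ne_zero_iff _).2 hx
    rw [hν₀def, MonoidWithZeroHom.comp_apply]
    change WithZero.lift' f (Valued.v x) = _
    conv_lhs => rw [← WithZero.exp_log hvx]
    rw [show WithZero.exp (WithZero.log (Valued.v x)) =
        ((Multiplicative.ofAdd (WithZero.log (Valued.v x)) : Multiplicative ℤ) : WithZero (Multiplicative ℤ)) from rfl,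
      WithZero.lift'_coe, hfdef, MonoidHom.comp_apply, zpowersHom_apply, Units.coeHom_apply]
    rfl
  set ν : (v.adicCompletion K)ˣ →* ℂˣ := Units.map ν₀.toMonoidHom with hνdef
  have hν : ∀ x : (v.adicCompletion K)ˣ, ν x = ζ ^ WithZero.log (Valued.v (x : v.adicCompletion K)) := by
    intro x
    apply Units.ext
    rw [hνdef, Units.coe_map]
    exact hν₀ x x.ne_zero
  refine ⟨ν, fun x => ?_, ?_, fun x hx => ?_, fun x => ?_, ?_⟩
  · -- unitary
    rw [hν, Units.val_zpow_eq_zpow_val, norm_zpow, hζnorm, one_zpow]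
  · -- continuous: locally constant on `K_v^×`
    refine (IsLocallyConstant.iff_eventually_eq _).2 (fun x₀ => ?_) |>.continuous
    have hx₀ : Valued.v (x₀ : v.adicCompletion K) ≠ 0 := (Valuation.ne_zero_iff _).2 x₀.ne_zero
    have hnhds : {y : (v.adicCompletion K)ˣ | Valued.v (y : v.adicCompletion K) = Valued.v (x₀ : v.adicCompletion K)} ∈
        nhds x₀ :=
      Units.continuous_val.continuousAt.preimage_mem_nhds (Valued.locally_const hx₀)
    refine Filter.mem_of_superset hnhds fun y hy => ?_
    simp only [Set.mem_setOf_eq] at hy ⊢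
    rw [hν, hν, hy]
  · -- trivial on `ord x = 0`
    rw [hν, hx, WithZero.log_one, zpow_zero]
  · -- order divides 3
    rw [hν, ← zpow_natCast, ← zpow_mul, mul_comm, zpow_mul, zpow_natCast, hζ3, one_zpow]
  · -- non-trivial at a uniformiser
    obtain ⟨π, hπ⟩ := IsDedekindDomain.HeightOneSpectrum.valuation_exists_uniformizer K v
    have hπv : Valued.v (π : v.adicCompletion K) = WithZero.exp (-1 : ℤ) := by
      rw [IsDedekindDomain.HeightOneSpectrum.valuedAdicCompletion_eq_valuation', hπ]
    have hπ0 : (π : v.adicCompletion K) ≠ 0 := by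
      intro h
      rw [h, map_zero] at hπv
      exact WithZero.exp_ne_zero hπv.symm
    refine ⟨Units.mk0 _ hπ0, ?_⟩
    rw [hν, Units.val_mk0, hπv, WithZero.log_exp, zpow_neg, zpow_one, Ne, inv_eq_one]
    exact hζne

end Cubic

/-! ## §4 The certificate: a two-member collection at a split place with `μ₀ ≠ μ₁`, same `ε`, same `χ` -/

section Certificate

open _root_.IsDedekindDomain _root_.NumberField
open scoped _root_.NumberField
open Literature.RepresentationTheory.Liu2021.SplitPlace (splitData not_isField unitaryToGL unitaryOfGL
  unitaryToGL_unitaryOfGL unitaryEquiv_apply unitaryEquiv_scalar normOneEquiv coe_unitaryToGL)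

/-- **The hypothesis pair «Lemma D.1 (1) for every member ∧ Lemma D.1 (3)» of the indexed reading is jointly satisfiable at
`n = 3`, NON-TRIVIALLY in `μ`** (T5-style in-kernel certificate, our bookkeeping): at a SPLIT place — `F = K_v` the completion
of any number field `K` at any finite place `v`, `E = F × F` with the swap (the tree's `splitData`, Gram matrix `(1, 1)`) —
there is a two-member collection `Lf : LemD1IndexedFamily F E 3 (Fin 2)` with the SAME Step-1 representative `ε = (1, −1)`
and the SAME Step-3 character `χ = 1` for both members but DIFFERENT Step-2 characters `μ₀ = 1 ≠ μ₁ = ν ⊗ ν²`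
(`ν = ζ₃^{ord_v}` the unramified cubic character), whose carriers `ω(μ₀, ε) = 1`, `ω(μ₁, ε) = ν ∘ det` (characters of
`U(V)(F) ≅ GL₃(F)` on `ℂ`) satisfy: `Lf.Item1AsPrinted` (each `ω(μ_i, ε, χ)` irreducible, admissible, non-zero, and both sides
of the printed equivalence (1) false) AND `LemD1_3AsPrintedI Lf` (the printed «isomorphic iff same `(μ, ε, χ)`» for all four
pairs of members) AND `ω(μ₁, ε, χ) ≇ ω(μ₀, ε, χ)`.  No statement about Liu's objects.
[cite: Liu2021, App. D Lemma D.1 (1) and (3)] -/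
theorem exists_lemD1IndexedFamily_item1AsPrinted_and_lemD1_3AsPrintedI (K : Type) [Field K] [NumberField K]
    (v : HeightOneSpectrum (𝓞 K)) :
    ∃ Lf : LemD1IndexedFamily (v.adicCompletion K) (v.adicCompletion K × v.adicCompletion K) 3 (Fin 2),
      Lf.Item1AsPrinted ∧ LemD1_3AsPrintedI Lf ∧
        Lf.mu 0 ≠ Lf.mu 1 ∧ Lf.eps 0 = Lf.eps 1 ∧ Lf.chi 0 = Lf.chi 1 ∧
        ¬ AreIsomorphicRep (Lf.quot 1) (Lf.quot 0) := by
  -- the local field `F = K_v`, `E = F × F`, and the split standing data `S` (Gram matrix `(1, 1)`, rank 3)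
  haveI hcz : CharZero (v.adicCompletion K) :=
    charZero_of_injective_algebraMap (algebraMap K (v.adicCompletion K)).injective
  have h2 : ringChar (v.adicCompletion K) ≠ 2 := by
    rw [ringChar.eq_zero]; decide
  have hH : IsUnit (1 : Matrix (Fin 3) (Fin 3) (v.adicCompletion K)).det := by simp
  have h23 : (2 : ℕ) ≤ 3 := by norm_num
  let S : OscillatorStandingData (v.adicCompletion K) (v.adicCompletion K × v.adicCompletion K) 3 :=
    splitData 1 hH h23 h2
  have hconj : ∀ x, S.conj x = x.swap := fun x => rfl
  -- the unramified cubic character `ν = ζ₃^{ord}` of `F^×`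
  obtain ⟨ν, hνnorm, hνcont, hνone, hν3, ϖ, hϖ⟩ := exists_cubic_unramified_character K v
  -- Step 1: the representative `ε = (1, −1) ∈ E^{−×}` (both members)
  let e : LemD1.EpsRep S :=
    ⟨MulEquiv.prodUnits.symm (1, -1), by
      change ((MulEquiv.prodUnits.symm (1, -1) : (v.adicCompletion K × v.adicCompletion K)ˣ) :
          v.adicCompletion K × v.adicCompletion K) ∈ S.skew
      rw [S.mem_skew_iff, hconj]
      simp [MulEquiv.prodUnits]⟩
  -- Step 3: the character `χ = 1` of `E¹` (both members)
  let χ : LemD1.ChiSet S := ⟨1, fun z => by simp, by simpa using continuous_const⟩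
  -- Step 2: at a split place every `a ∈ F^×` is a norm `x x^c` (`x = (a, 1)`), so «`μ|_{F^×}` has kernel `Nm E^×`» reads `μ|_{F^×} = 1`
  have hnormRHS : ∀ a : (v.adicCompletion K)ˣ, ∃ x : (v.adicCompletion K × v.adicCompletion K)ˣ,
      (x : v.adicCompletion K × v.adicCompletion K) * S.conj x =
        algebraMap (v.adicCompletion K) (v.adicCompletion K × v.adicCompletion K) (a : v.adicCompletion K) := fun a =>
    ⟨MulEquiv.prodUnits.symm (a, 1), by rw [hconj]; simp [MulEquiv.prodUnits, Prod.algebraMap_apply]⟩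
  -- `μ₀ = 1`
  let μ₀ : LemD1.MuSet S :=
    ⟨1, fun x => by simp, by simpa using continuous_const, fun a => iff_of_true (by simp) (hnormRHS a)⟩
  -- `μ₁ (x, y) = ν(x) ν(y)²`
  let f₁ : (v.adicCompletion K × v.adicCompletion K)ˣ →* ℂˣ :=
    ν.comp (Units.map (RingHom.fst (v.adicCompletion K) (v.adicCompletion K) :
      v.adicCompletion K × v.adicCompletion K →* v.adicCompletion K))
  let f₂ : (v.adicCompletion K × v.adicCompletion K)ˣ →* ℂˣ :=
    ν.comp (Units.map (RingHom.snd (v.adicCompletion K) (v.adicCompletion K) :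
      v.adicCompletion K × v.adicCompletion K →* v.adicCompletion K))
  have hf₁ : ∀ x, f₁ x = ν (Units.map (RingHom.fst (v.adicCompletion K) (v.adicCompletion K) :
      v.adicCompletion K × v.adicCompletion K →* v.adicCompletion K) x) := fun x => rfl
  have hf₂ : ∀ x, f₂ x = ν (Units.map (RingHom.snd (v.adicCompletion K) (v.adicCompletion K) :
      v.adicCompletion K × v.adicCompletion K →* v.adicCompletion K) x) := fun x => rfl
  let μ₁' : (v.adicCompletion K × v.adicCompletion K)ˣ →* ℂˣ := f₁ * (f₂ * f₂)
  have hμ₁' : ∀ x, μ₁' x = f₁ x * (f₂ x * f₂ x) := fun x => rfl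
  have hfst_alg : ∀ a : (v.adicCompletion K)ˣ,
      Units.map (RingHom.fst (v.adicCompletion K) (v.adicCompletion K) :
          v.adicCompletion K × v.adicCompletion K →* v.adicCompletion K)
        (Units.map (algebraMap (v.adicCompletion K) (v.adicCompletion K × v.adicCompletion K)).toMonoidHom a) = a :=
    fun a => Units.ext rfl
  have hsnd_alg : ∀ a : (v.adicCompletion K)ˣ,
      Units.map (RingHom.snd (v.adicCompletion K) (v.adicCompletion K) :
          v.adicCompletion K × v.adicCompletion K →* v.adicCompletion K)
        (Units.map (algebraMap (v.adicCompletion K) (v.adicCompletion K × v.adicCompletion K)).toMonoidHom a) = a :=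
    fun a => Units.ext rfl
  let μ₁ : LemD1.MuSet S :=
    ⟨μ₁',
      fun x => by
        rw [hμ₁', Units.val_mul, Units.val_mul, norm_mul, norm_mul, hf₁, hf₂, hνnorm, hνnorm, mul_one, mul_one],
      by
        have hc₁ : Continuous fun x : (v.adicCompletion K × v.adicCompletion K)ˣ => ((f₁ x : ℂˣ) : ℂ) :=
          hνcont.comp (Continuous.units_map _ (by exact continuous_fst))
        have hc₂ : Continuous fun x : (v.adicCompletion K × v.adicCompletion K)ˣ => ((f₂ x : ℂˣ) : ℂ) :=
          hνcont.comp (Continuous.units_map _ (by exact continuous_snd))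
        have heq : (fun x : (v.adicCompletion K × v.adicCompletion K)ˣ => ((μ₁' x : ℂˣ) : ℂ)) =
            fun x => ((f₁ x : ℂˣ) : ℂ) * (((f₂ x : ℂˣ) : ℂ) * ((f₂ x : ℂˣ) : ℂ)) := by
          funext x; rw [hμ₁', Units.val_mul, Units.val_mul]
        rw [heq]
        exact hc₁.mul (hc₂.mul hc₂),
      fun a => iff_of_true (by
        rw [hμ₁', hf₁, hf₂, hfst_alg, hsnd_alg]
        have h3 : ν a * (ν a * ν a) = ν a ^ 3 := by rw [pow_succ, pow_two, mul_assoc]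
        rw [h3, hν3]) (hnormRHS a)⟩
  have hμne' : μ₀ ≠ μ₁ := by
    intro h
    have h' := congrArg (fun μ : LemD1.MuSet S => μ.1 (MulEquiv.prodUnits.symm (ϖ, 1))) h
    have hfst : Units.map (RingHom.fst (v.adicCompletion K) (v.adicCompletion K) :
        v.adicCompletion K × v.adicCompletion K →* v.adicCompletion K) (MulEquiv.prodUnits.symm (ϖ, 1)) = ϖ :=
      Units.ext rfl
    have hsnd : Units.map (RingHom.snd (v.adicCompletion K) (v.adicCompletion K) :
        v.adicCompletion K × v.adicCompletion K →* v.adicCompletion K) (MulEquiv.prodUnits.symm (ϖ, 1)) = 1 :=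
      Units.ext rfl
    change (1 : (v.adicCompletion K × v.adicCompletion K)ˣ →* ℂˣ) (MulEquiv.prodUnits.symm (ϖ, 1)) =
      μ₁' (MulEquiv.prodUnits.symm (ϖ, 1)) at h'
    rw [MonoidHom.one_apply, hμ₁', hf₁, hf₂, hfst, hsnd, map_one, mul_one, mul_one] at h'
    exact hϖ h'.symm
  -- the carriers: the characters `1` and `λ = ν ∘ det ∘ (first factor)` of `U(V)(F) ≅ GL₃(F)` on the line `ℂ`
  let lam : S.U →* ℂˣ := ν.comp (Matrix.GeneralLinearGroup.det.comp (unitaryToGL 1 hH h23 h2))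
  have hlam : ∀ g : S.U, lam g = ν (Matrix.GeneralLinearGroup.det (unitaryToGL 1 hH h23 h2 g)) := fun g => rfl
  let ω₀ : Representation ℂ S.U ℂ := Representation.trivial ℂ S.U ℂ
  let ω₁ : Representation ℂ S.U ℂ := (DistribMulAction.toModuleEnd ℂ ℂ).comp lam
  have hω₀ : ∀ (g : S.U) (x : ℂ), ω₀ g x = x := fun g x => rfl
  have hω₁ : ∀ (g : S.U) (x : ℂ), ω₁ g x = (lam g : ℂ) * x := fun g x => by
    change (lam g : ℂˣ) • x = _
    rw [Units.smul_def, smul_eq_mul]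
  -- `λ` is trivial on the centre `E¹` (scalars `a·1`, `det = a³`, `ν³ = 1`)
  have hcen : ∀ z : S.normOne, lam (S.scalar z) = 1 := by
    intro z
    rw [hlam, ← unitaryEquiv_apply, unitaryEquiv_scalar]
    have hdet : Matrix.GeneralLinearGroup.det
        (OscillatorStandingData.unitScalar 3 (normOneEquiv 1 hH h23 h2 z)) = (normOneEquiv 1 hH h23 h2 z) ^ 3 := by
      apply Units.ext
      simp [Matrix.GeneralLinearGroup.val_det_apply, OscillatorStandingData.coe_unitScalar, Matrix.scalar_apply,
        Matrix.det_diagonal, Finset.prod_const]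
    rw [hdet, map_pow, hν3]
  have hcen₁ : ∀ z : S.normOne, lam (S.scalar z) = (1 : S.normOne →* ℂˣ) z := fun z => by
    rw [MonoidHom.one_apply]; exact hcen z
  -- `λ` is trivial on the open neighbourhood `{ord_v det g¹ = 0}` of `1`
  have hopen : ∃ O : Set S.U, IsOpen O ∧ (1 : S.U) ∈ O ∧ ∀ g ∈ O, lam g = 1 := by
    refine ⟨{g : S.U | Valued.v ((((g : GL (Fin 3) (v.adicCompletion K × v.adicCompletion K)) :
        Matrix (Fin 3) (Fin 3) (v.adicCompletion K × v.adicCompletion K)).map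
          (RingHom.fst (v.adicCompletion K) (v.adicCompletion K))).det) = 1}, ?_, ?_, ?_⟩
    · have hc : Continuous fun g : S.U => ((((g : GL (Fin 3) (v.adicCompletion K × v.adicCompletion K)) :
          Matrix (Fin 3) (Fin 3) (v.adicCompletion K × v.adicCompletion K)).map
            (RingHom.fst (v.adicCompletion K) (v.adicCompletion K))).det) :=
        ((Units.continuous_val.comp continuous_subtype_val).matrix_map (by exact continuous_fst)).matrix_det
      have hO : IsOpen {y : v.adicCompletion K | Valued.v y = 1} := by
        rw [isOpen_iff_mem_nhds]
        intro y hy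
        have hy' : Valued.v y ≠ 0 := by
          rw [Set.mem_setOf_eq] at hy; rw [hy]; exact one_ne_zero
        have hnh := Valued.locally_const hy'
        rw [Set.mem_setOf_eq] at hy
        rw [hy] at hnh
        exact hnh
      exact hO.preimage hc
    · simp [Matrix.map_one]
    · intro g hg
      rw [hlam]
      exact hνone _ hg
  -- the witness `g₀ = diag(ϖ, 1, 1) ∈ U(V)(F)`: `λ g₀ = ν(ϖ) ≠ 1`
  have hA₀det : (Matrix.diagonal ![(ϖ : v.adicCompletion K), 1, 1]).det ≠ 0 := by
    simp [Matrix.det_diagonal, Fin.prod_univ_three]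
  let A₀ : GL (Fin 3) (v.adicCompletion K) := Matrix.GeneralLinearGroup.mkOfDetNeZero _ hA₀det
  have hdetA₀ : Matrix.GeneralLinearGroup.det A₀ = ϖ := by
    apply Units.ext
    simp [A₀, Matrix.GeneralLinearGroup.val_det_apply, Matrix.det_diagonal, Fin.prod_univ_three]
  have hg₀ : lam (unitaryOfGL 1 hH h23 h2 A₀) ≠ 1 := by
    rw [hlam, unitaryToGL_unitaryOfGL, hdetA₀]
    exact hϖ
  -- the collection
  let Lf : LemD1IndexedFamily (v.adicCompletion K) (v.adicCompletion K × v.adicCompletion K) 3 (Fin 2) :=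
    { isNonarchimedeanLocalField := inferInstance
      isModuleTopology := inferInstance
      S := S
      mu := ![μ₀, μ₁]
      eps := fun _ => e
      chi := fun _ => χ
      V := fun _ => ℂ
      omega := ![ω₀, ω₁] }
  have hμne : Lf.mu 0 ≠ Lf.mu 1 := hμne'
  -- `ω(μ₁, ε, χ) ≇ ω(μ₀, ε, χ)`
  have hN₁ : augmentation (Lf.single 1).omega (Lf.single 1).S.scalar (Lf.single 1).chi = ⊥ :=
    augmentation_eq_bot_of_character (Lf.single 1) lam hω₁ hcen₁
  have hnotiso : ¬ AreIsomorphicRep (Lf.quot 1) (Lf.quot 0) :=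
    not_areIsomorphicRep_quotRep_of_character ω₁ ω₀ S.scalar_mem_center (1 : S.normOne →* ℂˣ) 1 lam hω₁ hω₀ hN₁ hg₀
  -- Lemma D.1, first sentence + (1), member by member
  have hItem1 : Lf.Item1AsPrinted := by
    intro i
    fin_cases i
    · exact lemD1_1AsPrinted_of_character (Lf.single 0) 1
        (fun g x => by rw [MonoidHom.one_apply, Units.val_one, one_mul]; exact hω₀ g x) (fun z => rfl)
        ⟨Set.univ, isOpen_univ, Set.mem_univ _, fun g _ => rfl⟩ (not_isField (v.adicCompletion K))
    · exact lemD1_1AsPrinted_of_character (Lf.single 1) lam hω₁ hcen₁ hopen (not_isField (v.adicCompletion K))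
  -- Lemma D.1 (3), for all four pairs of members
  have hrefl : ∀ k : Fin 2, (AreIsomorphicRep (Lf.quot k) (Lf.quot k) ↔
      (Lf.mu k = Lf.mu k ∧ LemD1.SameClass (Lf.eps k) (Lf.eps k) ∧ Lf.chi k = Lf.chi k)) :=
    fun k => iff_of_true (AreIsomorphicRep.refl _) ⟨rfl, ⟨1, by simp⟩, rfl⟩
  have hItem3 : LemD1_3AsPrintedI Lf := by
    intro _ i j
    fin_cases i <;> fin_cases j
    · exact hrefl 0
    · exact iff_of_false hnotiso fun h => hμne h.1.symm
    · exact iff_of_false (fun h => hnotiso h.symm) fun h => hμne h.1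
    · exact hrefl 1
  exact ⟨Lf, hItem1, hItem3, hμne, rfl, rfl, hnotiso⟩

/-- **Consequence**: the two printed records, read on an indexed collection, do NOT by their shape force the collapse «all
members carry the same Step-2 character `μ`» (so a conclusion `μ_i = μ_j` drawn from them downstream — the cross-`μ`
separation — is not vacuous-by-collapse), let alone `False`. [cite: Liu2021, App. D Lemma D.1 (1) and (3)] -/
theorem not_forall_mu_eq_of_item1AsPrinted_of_lemD1_3AsPrintedI (K : Type) [Field K] [NumberField K]
    (v : HeightOneSpectrum (𝓞 K)) :
    ¬ ∀ Lf : LemD1IndexedFamily (v.adicCompletion K) (v.adicCompletion K × v.adicCompletion K) 3 (Fin 2),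
        Lf.Item1AsPrinted → LemD1_3AsPrintedI Lf → ∀ i j : Fin 2, Lf.mu i = Lf.mu j := by
  intro h
  obtain ⟨Lf, h1, h3, hne, -, -, -⟩ := exists_lemD1IndexedFamily_item1AsPrinted_and_lemD1_3AsPrintedI K v
  exact hne (h Lf h1 h3 0 1)

end Certificate

end LemD1IndexedNonVacuity

end Literature.NumberTheory.Automorphic.Liu2021

end
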